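import Summits.SmoothPoincare4.SmoothPoincare4.Theorems.CylinderEntropySliceIsolationStubSeparationPersistsAux8
import HarnessLib

/-!
# End-separation persists along a cylinder flow (stub `stub_separationPersists`)

Stub `stub_separationPersists` (γ3 · END-SEPARATION PERSISTS ALONG A CYLINDER FLOW) of line
`conformal-kernel-domination` (closing chain γ "thin-flow graphicality") for the crux
`CylinderEntropy.SliceIsolation` (stmt-SmoothPoincare4-7632), registered signature, proved without
named facts (parts 1–8 in the sibling files `…StubSeparationPersistsAux1…8.lean`, assembled here).

## Statement

Along a smooth mean curvature flow `IsCylinderMCF M F ν T` of embedded cross-sections of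
`N = S⁴ × ℝ = {z ∈ ℝ⁶ | ∑_{i<5} zᵢ² = 1}` of a compact connected `4`-manifold `M` (vocabulary of crux
7631), if the initial slice `F T (M)` separates the two ends of `N` (`SeparatesEnds`: no path in the
complement from far below to far above) then so does every slice `F t (M)`, `t ≥ T`.

## Proof

Isotopy invariance of end-separation, by continuous induction on `[T, t]`
(`IsClosed.Icc_subset_of_forall_mem_nhdsWithin`) — the set of separating times `≥ T` is

* CLOSED (part 7, `cylFlow_isClosed_separatesEnds`): a path joining the two ends off `F t (M)` is
  compact, at positive distance from the compact slice, hence off the uniformly close slices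
  `F tₙ (M)`; end-separation may be tested with any radius beyond a uniform height bound;
* OPEN in `[T, ∞)` (`cylFlow_separatesEnds_near`, from part 8): with `Σ = F t (M)`,
  (i) every point of `N ∖ Σ` is joined off `Σ` to one of the two push-offs
  `P± = nrm(F(t,x₀) ± τ₀ ν(t,x₀))` (parts 1–4: inverse function theorem for the augmented tube chart
  `(b, r, ρ) ↦ (1+ρ) ⊙ nrm(ι φ⁻¹ b + r ν)`, whose differential `Dι ⊕ ν ⊕ n` is invertible, plus
  connectedness of `N`); (ii) `P₊ ≁ P₋` off `Σ` by the Jordan–Brouwer separation theorem for the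
  compact topological hypersurface `Φ(Σ) ≅ M` of `ℝ⁵`, `Φ(z) = e^{z₅} z'` the conformal
  diffeomorphism `N ≅ ℝ⁵ ∖ {0}` (tree theorem
  `Literature.Topology.FourManifolds.not_isPreconnected_compl_of_homeomorph_closedManifold`,
  Alexander duality with `ℤ/2` coefficients); (iii) the push-off radius `τ₀` is uniform for nearby
  times and unit normals converge up to sign (parts 5–6: strict differentiability of the JOINT chart
  representative `(s, a) ↦ F s (φ⁻¹ a)` — joint `C¹`-smoothness is the only input from the flow; no
  continuity of `ν` in time is used, its sign may flip), so for `s` near `t` two reference far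
  points `a ≁ b` stay joined off `F s (M)` to push-offs of `F s (M)` on different sides, hence stay
  non-joined: end-separation of `F s (M)`.

## References

* M. W. Hirsch, *Differential Topology*, GTM 33 (1976), Ch. 4 §5 (tubular neighbourhoods), Ch. 8
  Thm. 1.3 (isotopy extension). [HirschDT1976]
* A. Hatcher, *Algebraic Topology*, CUP (2002), Prop. 3.46 (Jordan–Brouwer separation via Alexander
  duality). [HatcherAT2002]
-/

set_option linter.dupNamespace false

noncomputable section

open MeasureTheory Set Function Filter Module Asymptotics Metric
open scoped Manifold ContDiff ENNReal Topology RealInnerProductSpace NNReal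

namespace Summit.SmoothPoincare4.SmoothPoincare4.Theorems.CylinderEntropySliceIsolation

open Summit.SmoothPoincare4.SmoothPoincare4.Theorems.CylinderRungTwo.KillingFlux
open Literature.Geometry.Riemannian
open Literature.Geometry.Lorentzian Literature.Geometry.Lorentzian.PseudoRiemannianMetric
open Literature.Geometry.Riemannian.SphericalCylinderEntropy (truncL truncL_apply lipschitz_truncL)
open Literature.Geometry.Manifold.CylinderSlice (axis castSucc_ne_five padL padL_apply_castSucc
  padL_apply_last)

section Assembly

open Summit.SmoothPoincare4.SmoothPoincare4.Cruxes.CylinderRungTwo.KillingFlux (IsCylinderMCF SeparatesEnds cylN)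

variable {M : Type} [TopologicalSpace M] [ChartedSpace (EuclideanSpace ℝ (Fin 4)) M]
  [IsManifold (𝓡 4) ∞ M]

variable {F : ℝ → M → EuclideanSpace ℝ (Fin 6)} {ν : ℝ → M → EuclideanSpace ℝ (Fin 6)} {T : ℝ}

/-- **The set of separating times is open in `[T, ∞)`**: if `F t (M)` separates the ends
(`t ≥ T`), so does `F s (M)` for all times `s ≥ T` close to `t`.  Two reference far points
`a, b` over `x₀` (heights `∓(|B| + 1)`, `B` a height bound on `[T, t+1]`) are each joined in
`N ∖ F t (M)` to one of the two reference push-offs `P± = nrm(F(t,x₀) ± τ₀ ν(t,x₀))`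
(`joinedIn_pushoff_or`), to different ones since `a ≁ b`; then `cylFlow_not_joinedIn_near` keeps
`a ≁ b` in `N ∖ F s (M)`, which is end-separation with radius `|B| + 1`. [folklore] -/
theorem cylFlow_separatesEnds_near [T2Space M] [CompactSpace M] [ConnectedSpace M] (h : IsCylinderMCF M F ν T)
    {t : ℝ} (ht : T ≤ t) (hsep : SeparatesEnds (range (F t))) :
    ∃ θ : ℝ, 0 < θ ∧ ∀ s : ℝ, T ≤ s → |s - t| < θ → SeparatesEnds (range (F s)) := by
  obtain ⟨x₀⟩ := (inferInstance : Nonempty M)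
  obtain ⟨B, hB⟩ := cylFlow_height_bound h t
  have hBs : ∀ s : ℝ, T ≤ s → |s - t| < 1 → ∀ z ∈ range (F s), |z 5| ≤ B := by
    rintro s hsT hst _ ⟨x, rfl⟩
    exact hB s ⟨hsT, by have := (abs_lt.1 hst).2; linarith⟩ x
  have hBt : ∀ z ∈ range (F t), |z 5| ≤ B := hBs t ht (by simp)
  obtain ⟨τ₀, hτ₀, θ₁, hθ₁, hpo⟩ := cylFlow_exists_uniform_pushoff h ht
  have hpot : ∀ x : M, ∀ τ ∈ Ioc (0 : ℝ) τ₀,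
      (fun z : EuclideanSpace ℝ (Fin 6) => (‖truncL z‖⁻¹ : ℝ) • (z - z (5 : Fin 6) •
        (axis : EuclideanSpace ℝ (Fin 6))) + z (5 : Fin 6) • (axis : EuclideanSpace ℝ (Fin 6))) (F t x + τ • ν t x) ∉
          range (F t) ∧
      (fun z : EuclideanSpace ℝ (Fin 6) => (‖truncL z‖⁻¹ : ℝ) • (z - z (5 : Fin 6) •
        (axis : EuclideanSpace ℝ (Fin 6))) + z (5 : Fin 6) • (axis : EuclideanSpace ℝ (Fin 6))) (F t x + τ • (-ν t x)) ∉
          range (F t) := fun x τ hτ => hpo t ht (by simp [hθ₁]) x τ hτ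
  have hιN := h.mem_cyl t ht
  -- the reference far points
  have hp₀ : ∑ i : Fin 5, (truncL (F t x₀)) i ^ 2 = 1 := by simpa [truncL_apply] using hιN x₀
  set a : EuclideanSpace ℝ (Fin 6) := padL (truncL (F t x₀)) + (-(|B| + 1)) • (axis : EuclideanSpace ℝ (Fin 6)) with ha
  set b : EuclideanSpace ℝ (Fin 6) := padL (truncL (F t x₀)) + (|B| + 1) • (axis : EuclideanSpace ℝ (Fin 6)) with hb
  have haN : ∑ i : Fin 5, a (Fin.castSucc i) ^ 2 = 1 := vert_mem_Ncyl hp₀ _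
  have hbN : ∑ i : Fin 5, b (Fin.castSucc i) ^ 2 = 1 := vert_mem_Ncyl hp₀ _
  have ha5 : a 5 = -(|B| + 1) := vert_apply_five _ _
  have hb5 : b 5 = |B| + 1 := vert_apply_five _ _
  have haS : a ∉ range (F t) := fun hmem => by
    have := hBt a hmem; rw [ha5, abs_neg, abs_of_pos (by positivity : (0 : ℝ) < |B| + 1)] at this
    linarith [le_abs_self B]
  have hbS : b ∉ range (F t) := fun hmem => by
    have := hBt b hmem; rw [hb5, abs_of_pos (by positivity : (0 : ℝ) < |B| + 1)] at this
    linarith [le_abs_self B]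
  have hab : ¬ JoinedIn (({z : EuclideanSpace ℝ (Fin 6) | ∑ i : Fin 5, z (Fin.castSucc i) ^ 2 = 1} :
      Set (EuclideanSpace ℝ (Fin 6))) \ range (F t)) a b :=
    not_joinedIn_of_separatesEnds hBt hsep (by linarith [le_abs_self B] : B < |B| + 1) haN hbN
      (by rw [ha5]) (by rw [hb5])
  -- each far point is on one of the two sides of `F t (M)`
  have hor_a := joinedIn_pushoff_or (h.isSmoothEmbedding t ht) hιN (h.contMDiff_normal t ht) (h.isUnitNormal t ht)
    (h.normal_tangent t ht) hτ₀ hpot x₀ (z := a) ⟨haN, haS⟩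
  have hor_b := joinedIn_pushoff_or (h.isSmoothEmbedding t ht) hιN (h.contMDiff_normal t ht) (h.isUnitNormal t ht)
    (h.normal_tangent t ht) hτ₀ hpot x₀ (z := b) ⟨hbN, hbS⟩
  -- conclude from the core lemma, for a direction `w₀ = ± ν(t, x₀)`
  have hconclude : ∀ {w₀ : EuclideanSpace ℝ (Fin 6)}, (w₀ = ν t x₀ ∨ w₀ = -ν t x₀) →
      JoinedIn (({z : EuclideanSpace ℝ (Fin 6) | ∑ i : Fin 5, z (Fin.castSucc i) ^ 2 = 1} :
        Set (EuclideanSpace ℝ (Fin 6))) \ range (F t)) a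
        ((fun z : EuclideanSpace ℝ (Fin 6) => (‖truncL z‖⁻¹ : ℝ) • (z - z (5 : Fin 6) •
          (axis : EuclideanSpace ℝ (Fin 6))) + z (5 : Fin 6) • (axis : EuclideanSpace ℝ (Fin 6))) (F t x₀ + τ₀ • (-w₀))) →
      JoinedIn (({z : EuclideanSpace ℝ (Fin 6) | ∑ i : Fin 5, z (Fin.castSucc i) ^ 2 = 1} :
        Set (EuclideanSpace ℝ (Fin 6))) \ range (F t)) b
        ((fun z : EuclideanSpace ℝ (Fin 6) => (‖truncL z‖⁻¹ : ℝ) • (z - z (5 : Fin 6) •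
          (axis : EuclideanSpace ℝ (Fin 6))) + z (5 : Fin 6) • (axis : EuclideanSpace ℝ (Fin 6))) (F t x₀ + τ₀ • w₀)) →
      ∃ θ : ℝ, 0 < θ ∧ ∀ s : ℝ, T ≤ s → |s - t| < θ → SeparatesEnds (range (F s)) := by
    intro w₀ hw₀ haQ hbQ
    obtain ⟨θ, hθ, hnot⟩ := cylFlow_not_joinedIn_near h ht x₀ hτ₀ hθ₁ hpo hw₀ haQ hbQ
    refine ⟨min θ 1, by positivity, fun s hsT hst => ?_⟩
    exact separatesEnds_of_not_joinedIn (hBs s hsT (lt_of_lt_of_le hst (min_le_right _ _))) haN hbN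
      (by rw [ha5]; linarith [le_abs_self B]) (by rw [hb5]; linarith [le_abs_self B])
      (hnot s hsT (lt_of_lt_of_le hst (min_le_left _ _)))
  rcases hor_a with haP | haM <;> rcases hor_b with hbP | hbM
  · exact absurd (haP.trans hbP.symm) hab
  · exact hconclude (Or.inr rfl) (by rw [neg_neg]; exact haP) hbM
  · exact hconclude (Or.inl rfl) haM hbP
  · exact absurd (haM.trans hbM.symm) hab

/-- **STUB γ3 `stub_separationPersists` (line `conformal-kernel-domination`, chain γ): end-separation
persists along a cylinder flow.**  Along a smooth mean curvature flow `IsCylinderMCF M F ν T` of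
embedded cross-sections of `N = S⁴ × ℝ` of a compact connected `4`-manifold `M`, if the initial
slice `F T (M)` separates the two ends of `N` then so does every later slice `F t (M)`, `t ≥ T`.

Proof (parts 1–4 of the `…StubSeparationPersists*` files, no named facts): the set
`S = {t ≥ T | F t (M) separates}` contains `T`, is CLOSED (`cylFlow_isClosed_separatesEnds`: a path
joining the ends off `F t (M)` is compact and misses the uniformly close slices `F tₙ (M)`), and is
OPEN in `[T, ∞)` (`cylFlow_separatesEnds_near`): (i) every point of `N ∖ Σ`, `Σ = F t (M)`, is joined
to one of the two push-offs `P± = nrm(F(t,x₀) ± τ₀ ν(t,x₀))` (inverse function theorem for the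
augmented tube chart + connectedness of `N`), (ii) `P₊ ≁ P₋` in `N ∖ Σ` by the Jordan–Brouwer
separation theorem for the compact hypersurface `Φ(Σ) ≅ M` of `ℝ⁵` (conformal map
`Φ(z) = e^{z₅} z'`; tree theorem `not_isPreconnected_compl_of_homeomorph_closedManifold`, Alexander
duality), (iii) the push-off radius `τ₀` is uniform for nearby times and unit normals converge up
to sign (joint `C¹`-smoothness: strict differentiability of the joint chart representative), so
for `s` near `t` the far points stay joined to push-offs of `F s (M)` on different sides, hence
are not joined off `F s (M)`.  The continuous induction `IsClosed.Icc_subset_of_forall_mem_nhdsWithin`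
concludes. [cite: HirschDT1976, Ch. 8 Thm. 1.3; Ch. 4 §5] -/
theorem stub_separationPersists :
    ∀ (M : Type) [TopologicalSpace M] [T2Space M] [SecondCountableTopology M]
      [ChartedSpace (EuclideanSpace ℝ (Fin 4)) M] [IsManifold (𝓡 4) ∞ M] [CompactSpace M] [ConnectedSpace M]
      (F : ℝ → M → EuclideanSpace ℝ (Fin 6)) (ν : ℝ → M → EuclideanSpace ℝ (Fin 6)) (T : ℝ),
      Summit.SmoothPoincare4.SmoothPoincare4.Cruxes.CylinderRungTwo.KillingFlux.IsCylinderMCF M F ν T →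
      Summit.SmoothPoincare4.SmoothPoincare4.Cruxes.CylinderRungTwo.KillingFlux.SeparatesEnds (Set.range (F T)) →
      ∀ t : ℝ, T ≤ t →
        Summit.SmoothPoincare4.SmoothPoincare4.Cruxes.CylinderRungTwo.KillingFlux.SeparatesEnds (Set.range (F t)) := by
  intro M _ _ _ _ _ _ _ F ν T h hsep t ht
  set S : Set ℝ := {t | T ≤ t ∧ SeparatesEnds (range (F t))} with hS
  have hclosed : IsClosed S := cylFlow_isClosed_separatesEnds h
  have hsub : Icc T t ⊆ S := by
    refine (hclosed.inter isClosed_Icc).Icc_subset_of_forall_mem_nhdsWithin ⟨le_rfl, hsep⟩ ?_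
    rintro x ⟨⟨hxT, hxsep⟩, -⟩
    obtain ⟨θ, hθ, hnear⟩ := cylFlow_separatesEnds_near h hxT hxsep
    rw [mem_nhdsGT_iff_exists_Ioo_subset]
    refine ⟨x + θ, by simpa using hθ, fun s hs => ⟨hxT.trans hs.1.le, hnear s (hxT.trans hs.1.le) ?_⟩⟩
    rw [abs_lt]; constructor <;> linarith [hs.1, hs.2]
  exact (hsub ⟨ht, le_rfl⟩).2

end Assembly

end Summit.SmoothPoincare4.SmoothPoincare4.Theorems.CylinderEntropySliceIsolation
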